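import Literature.MathematicalPhysics.QuantumFieldTheory.BalabanImbrieJaffe1984to88.BIJ88Sect5StatementsPart4

/-!
# `BalabanImbrieJaffe1984to88.BIJ88ScalarTransl582` — T. Bałaban, J. Imbrie, A. Jaffe, *Effective action and cluster
properties of the abelian Higgs model*, Commun. Math. Phys. **114** (1988) 257–315 [BalabanImbrieJaffe1988], §5.8 *Scalar
Field Translation*, p. 295: the expansion of the scalar quadratic forms under the translation (5.8.1) — the terms quadratic in
`φ^{(k)}` **(5.8.2)** with `𝒬₄`, the cross terms and the terms quadratic in `ψ` — PROVED as inner-product algebra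

statement-level skeleton of published theorems with citation tags; proofs where landed; nothing here is a claim about the Yang–Mills mass gap

PDF held: `paper:balaban1988-cmp114-bij-abelian-higgs-effective-action` (journal page = PDF page + 256).  Renders read this
session: p. 295 = PDF 39, p. 296 = PDF 40 (`pages/original-p039-x2.png`, `-p040-x2.png` of the p02 seat, read as images).

**What the paper prints (p. 295, verbatim).**  *"The scalar field quadratic forms, after all our manipulations with the gauge field,
are as follows: ½⟨Λ₈^{(k−1)′}φ, Δ_{k,loc}(ũ_{k+1})Λ₈^{(k−1)′}φ⟩ + ½aL^{−2}⟨ψ − Q(ũ_{k+1})φ, ψ − Q(ũ_{k+1})φ⟩. To eliminate most of the linear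
term ⟨ψ, Q(ũ_{k+1})φ⟩ in the small field region, we make a translation φ = φ^{(k)} + aL^{−2}Λ₇^{(k)}C^{(k)}_{loc}(u_{k+1})Q*(u_{k+1})ψ. (5.8.1)
(Recall that u_{k+1} = ũ_{k+1} in Λ̄₆^{(k)}.) The terms quadratic in φ^{(k)} are then ½⟨Λ₈^{(k−1)′}φ^{(k)}, (Δ_{k,loc}(ũ_{k+1}) +
aL^{−2}P(ũ_{k+1}))Λ₈^{(k−1)′}φ^{(k)}⟩ + 𝒬₄, (5.8.2) where 𝒬₄ = ½aL^{−2}⟨φ^{(k)}, Λ₈^{(k−1)′c}P(ũ_{k+1})φ^{(k)}⟩. In the cross terms between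
φ^{(k)} and ψ, we write ψ = Λ₈^{(k)′}ψ + Λ₈^{(k)′c}ψ. The terms with Λ₈^{(k)′c}ψ define 𝒬₅, a form localized near Λ₈^{(k)′c}. The other
terms can be written as ⟨φ^{(k)}, w₆ψ⟩, with w₆ a small kernel with range less than r(e_k). This is because (5.8.1) would eliminate
entirely the linear term were it not for the localizations."*  ((4.10) p. 275: `P(u_k) = Q(u_k)*Q(u_k)`.)

**What is reproduced here (kernel-checked, zero `sorry`, no named facts).**  Real inner-product spaces `M` (unit-lattice scalar
fields `φ`, print: complex values read as pairs of reals) and `N` (block fields `ψ`); linear maps `Λ8` (the characteristic function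
`Λ₈^{(k−1)′}`), `Δ` (`Δ_{k,loc}(ũ_{k+1})`), `Q : M → N` (`Q(ũ_{k+1})`), `P` (`P(ũ_{k+1}) = Q*Q`), and the translation written
`φ = φ^{(k)} + Tψ` for ANY linear `T : N → M` (the printed one is `T = aL^{−2}Λ₇^{(k)}C^{(k)}_{loc}Q*` — r16's
`BIJ88Sect5StatementsPart4.transl581`, `transl581_eq`); `a` stands for the printed `aL^{−2}`.
* DEFINITIONS (bodies = the printed brackets): `scalarForms` (the two forms before translation), **`Q4`** (`𝒬₄ =
  ½a⟨φ^{(k)}, Λ₈ᶜPφ^{(k)}⟩`, `Λ₈ᶜ = 1 − Λ₈`), **`quadPhi`** (the right side of (5.8.2)), `crossTerms` (the terms bilinear in `φ^{(k)}`,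
  `ψ`), `quadPsi` (the terms quadratic in `ψ`).
* **`expand_transl`** — the bookkeeping: `scalarForms(φ^{(k)} + Tψ, ψ) = [½⟨Λ₈φ^{(k)}, ΔΛ₈φ^{(k)}⟩ + ½a⟨Qφ^{(k)}, Qφ^{(k)}⟩] + crossTerms
  + quadPsi` for symmetric `Δ`.
* **`eq582`** — **(5.8.2)**: the bracket equals `quadPhi = ½⟨Λ₈φ^{(k)}, (Δ + aP)Λ₈φ^{(k)}⟩ + 𝒬₄` when `P = Q*Q` (`⟨Qx, Qy⟩ = ⟨x, Py⟩`),
  `Λ₈` is a symmetric idempotent (a characteristic function) and `Λ₈P = PΛ₈` (reading (i)); `eq582_transl` — both together: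
  `scalarForms(φ^{(k)} + Tψ, ψ) = quadPhi + crossTerms + quadPsi`.
* `crossTerms_eq_inner` — *"(5.8.1) would eliminate entirely the linear term were it not for the localizations"*: the cross terms
  are `⟨φ^{(k)}, Wψ⟩` with `W = Λ₈ΔΛ₈T − aQ*(1 − QT)` (given the adjoint `Q*`), so they vanish exactly when `aQ*(1 − QT) = Λ₈ΔΛ₈T` —
  for `Λ₈ = 1` and `T = aCQ*`, `C = (Δ + aP)^{−1}` this is B1's exact elimination (p14's `B1Eq314Proof`); with the localizations
  `Λ₇`, `C_{loc}` the residual `W` is the paper's `w₆` plus the `𝒬₅` part (their smallness is NOT claimed).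

**Readings (declared).**  (i) `Λ₈^{(k−1)′}P(ũ_{k+1}) = P(ũ_{k+1})Λ₈^{(k−1)′}`: the region is a union of `L`-blocks and `P = Q*Q` is
block-local — the hypothesis under which the printed `𝒬₄ = ½aL^{−2}⟨φ^{(k)}, Λ₈^{(k−1)′c}Pφ^{(k)}⟩` is the exact complement; (ii) real
Hilbert-space reading of `⟨·,·⟩`; (iii) `𝒬₅`, `w₆`, `𝒬₆`, `w₇` and the identity of [7] on p. 296 are not split out of `crossTerms` ∕
`quadPsi` here (r16's `IdentityB1p296`, p02 g3's `BIJ88IdentityB1p296Proof`).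

**What is NOT claimed.**  The smallness/range of `w₆`, `w₇`, the localization of `𝒬₄`, `𝒬₅`, `𝒬₆` near `Λ₈^{(k)′c}`, the form
`Δ^L_{k+1,loc}` and the summary (5.8.3); anything of B1–B16.  NOT summit progress; NOT continuum; NOT Clay.  Imports: r16's
`BIJ88Sect5StatementsPart4` (for `transl581`); no Summits import; sub-namespace `…BIJ88ScalarTransl582`; modifies nothing.  Cell
`lit-balaban` Phase 2, seat p02 gen 4; row C2.Eq5.8.1-5.8.3 (owner r16), member (5.8.2) «absent» → proved (under reading (i)).
-/

open scoped RealInnerProductSpace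

namespace Literature.MathematicalPhysics.QuantumFieldTheory.BalabanImbrieJaffe1984to88.BIJ88ScalarTransl582

variable {M N : Type*} [NormedAddCommGroup M] [InnerProductSpace ℝ M] [NormedAddCommGroup N] [InnerProductSpace ℝ N]

/-- p. 295, verbatim: *"The scalar field quadratic forms … are as follows: ½⟨Λ₈^{(k−1)′}φ, Δ_{k,loc}(ũ_{k+1})Λ₈^{(k−1)′}φ⟩ +
½aL^{−2}⟨ψ − Q(ũ_{k+1})φ, ψ − Q(ũ_{k+1})φ⟩"* (`a` = the printed `aL^{−2}`). [cite: BalabanImbrieJaffe1988, (5.8.1) p.295] -/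
noncomputable def scalarForms (a : ℝ) (Λ8 Δ : M →ₗ[ℝ] M) (Q : M →ₗ[ℝ] N) (φ : M) (ψ : N) : ℝ :=
  (1 / 2) * ⟪Λ8 φ, Δ (Λ8 φ)⟫ + (1 / 2) * a * ⟪ψ - Q φ, ψ - Q φ⟫

/-- **`𝒬₄`** (5.8.2) p. 295, verbatim: *"𝒬₄ = ½aL^{−2}⟨φ^{(k)}, Λ₈^{(k−1)′c}P(ũ_{k+1})φ^{(k)}⟩"* (`Λ₈ᶜ = 1 − Λ₈`).
[cite: BalabanImbrieJaffe1988, (5.8.2) p.295] -/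
noncomputable def Q4 (a : ℝ) (Λ8 P : M →ₗ[ℝ] M) (φk : M) : ℝ :=
  (1 / 2) * a * ⟪φk, P φk - Λ8 (P φk)⟫

/-- the right-hand side of **(5.8.2)**: `½⟨Λ₈φ^{(k)}, (Δ + aP)Λ₈φ^{(k)}⟩ + 𝒬₄`. [cite: BalabanImbrieJaffe1988, (5.8.2) p.295] -/
noncomputable def quadPhi (a : ℝ) (Λ8 Δ P : M →ₗ[ℝ] M) (φk : M) : ℝ :=
  (1 / 2) * ⟪Λ8 φk, Δ (Λ8 φk) + a • P (Λ8 φk)⟫ + Q4 a Λ8 P φk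

/-- *"the cross terms between φ^{(k)} and ψ"* after the translation `φ = φ^{(k)} + Tψ`:
`⟨Λ₈φ^{(k)}, ΔΛ₈Tψ⟩ − a⟨Qφ^{(k)}, ψ − QTψ⟩`. [cite: BalabanImbrieJaffe1988, (5.8.2) p.295] -/
noncomputable def crossTerms (a : ℝ) (Λ8 Δ : M →ₗ[ℝ] M) (Q : M →ₗ[ℝ] N) (T : N →ₗ[ℝ] M) (φk : M) (ψ : N) : ℝ :=
  ⟪Λ8 φk, Δ (Λ8 (T ψ))⟫ - a * ⟪Q φk, ψ - Q (T ψ)⟫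

/-- *"the terms quadratic in ψ"* after the translation: `½⟨Λ₈Tψ, ΔΛ₈Tψ⟩ + ½a⟨ψ − QTψ, ψ − QTψ⟩`.
[cite: BalabanImbrieJaffe1988, (5.8.3) p.296] -/
noncomputable def quadPsi (a : ℝ) (Λ8 Δ : M →ₗ[ℝ] M) (Q : M →ₗ[ℝ] N) (T : N →ₗ[ℝ] M) (ψ : N) : ℝ :=
  (1 / 2) * ⟪Λ8 (T ψ), Δ (Λ8 (T ψ))⟫ + (1 / 2) * a * ⟪ψ - Q (T ψ), ψ - Q (T ψ)⟫

/-- r16's typed translation (5.8.1) `transl581` is `φ^{(k)} + Tψ` with `T = aL^{−2}·Λ₇C_{loc}Q*`. [cite: BalabanImbrieJaffe1988, (5.8.1) p.295] -/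
theorem transl581_eq {M' N' : Type*} [AddCommGroup M'] [Module ℝ M'] [AddCommGroup N'] [Module ℝ N'] (a L : ℝ)
    (Λ7 Cloc : Module.End ℝ M') (Qst : N' →ₗ[ℝ] M') (φk : M') (ψ : N') :
    BIJ88Sect5StatementsPart4.transl581 a L Λ7 Cloc Qst φk ψ = φk + ((a * L⁻¹ ^ 2) • (Λ7 ∘ₗ Cloc ∘ₗ Qst)) ψ := by
  simp [BIJ88Sect5StatementsPart4.transl581]

/-- The bookkeeping of the translation: for symmetric `Δ`, `scalarForms(φ^{(k)} + Tψ, ψ) = [½⟨Λ₈φ^{(k)}, ΔΛ₈φ^{(k)}⟩ +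
½a⟨Qφ^{(k)}, Qφ^{(k)}⟩] + crossTerms + quadPsi` (the quadratic, bilinear and `ψ`-quadratic parts).
[cite: BalabanImbrieJaffe1988, (5.8.2) p.295] -/
theorem expand_transl (a : ℝ) {Λ8 Δ : M →ₗ[ℝ] M} (hΔ : ∀ x y : M, ⟪Δ x, y⟫ = ⟪x, Δ y⟫) (Q : M →ₗ[ℝ] N) (T : N →ₗ[ℝ] M)
    (φk : M) (ψ : N) :
    scalarForms a Λ8 Δ Q (φk + T ψ) ψ =
      ((1 / 2) * ⟪Λ8 φk, Δ (Λ8 φk)⟫ + (1 / 2) * a * ⟪Q φk, Q φk⟫)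
        + crossTerms a Λ8 Δ Q T φk ψ + quadPsi a Λ8 Δ Q T ψ := by
  simp only [scalarForms, crossTerms, quadPsi, map_add]
  have hu : ψ - (Q φk + Q (T ψ)) = (ψ - Q (T ψ)) - Q φk := by abel
  rw [hu]
  have hsym : ⟪Λ8 (T ψ), Δ (Λ8 φk)⟫ = ⟪Λ8 φk, Δ (Λ8 (T ψ))⟫ := by
    rw [real_inner_comm, hΔ]
  simp only [inner_add_left, inner_add_right, inner_sub_left, inner_sub_right, hsym]
  rw [real_inner_comm (Q φk) ψ, real_inner_comm (Q φk) (Q (T ψ))]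
  ring

/-- **(5.8.2)** p. 295 [PDF 39], verbatim: *"The terms quadratic in φ^{(k)} are then ½⟨Λ₈^{(k−1)′}φ^{(k)}, (Δ_{k,loc}(ũ_{k+1}) +
aL^{−2}P(ũ_{k+1}))Λ₈^{(k−1)′}φ^{(k)}⟩ + 𝒬₄, (5.8.2) where 𝒬₄ = ½aL^{−2}⟨φ^{(k)}, Λ₈^{(k−1)′c}P(ũ_{k+1})φ^{(k)}⟩"* — PROVED: the
`φ^{(k)}`-quadratic bracket `½⟨Λ₈φ^{(k)}, ΔΛ₈φ^{(k)}⟩ + ½a⟨Qφ^{(k)}, Qφ^{(k)}⟩` equals `quadPhi` when `P = Q*Q`, `Λ₈` is a symmetric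
idempotent commuting with `P` (reading (i)). [cite: BalabanImbrieJaffe1988, (5.8.2) p.295] -/
theorem eq582 (a : ℝ) {Λ8 P : M →ₗ[ℝ] M} (Δ : M →ₗ[ℝ] M) {Q : M →ₗ[ℝ] N} (hP : ∀ x y : M, ⟪Q x, Q y⟫ = ⟪x, P y⟫)
    (hΛsym : ∀ x y : M, ⟪Λ8 x, y⟫ = ⟪x, Λ8 y⟫) (hΛΛ : ∀ x : M, Λ8 (Λ8 x) = Λ8 x) (hΛP : ∀ x : M, Λ8 (P x) = P (Λ8 x))
    (φk : M) :
    (1 / 2) * ⟪Λ8 φk, Δ (Λ8 φk)⟫ + (1 / 2) * a * ⟪Q φk, Q φk⟫ = quadPhi a Λ8 Δ P φk := by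
  have h1 : ⟪Λ8 φk, P (Λ8 φk)⟫ = ⟪φk, Λ8 (P φk)⟫ := by
    rw [hΛsym, ← hΛP, hΛΛ]
  simp only [quadPhi, Q4, inner_add_right, inner_sub_right, real_inner_smul_right, hP, h1]
  ring

/-- **(5.8.2) with the translation**: `scalarForms(φ^{(k)} + Tψ, ψ) = [½⟨Λ₈φ^{(k)}, (Δ + aP)Λ₈φ^{(k)}⟩ + 𝒬₄] + crossTerms + quadPsi`.
[cite: BalabanImbrieJaffe1988, (5.8.2) p.295] -/
theorem eq582_transl (a : ℝ) {Λ8 Δ P : M →ₗ[ℝ] M} {Q : M →ₗ[ℝ] N} (hΔ : ∀ x y : M, ⟪Δ x, y⟫ = ⟪x, Δ y⟫)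
    (hP : ∀ x y : M, ⟪Q x, Q y⟫ = ⟪x, P y⟫) (hΛsym : ∀ x y : M, ⟪Λ8 x, y⟫ = ⟪x, Λ8 y⟫)
    (hΛΛ : ∀ x : M, Λ8 (Λ8 x) = Λ8 x) (hΛP : ∀ x : M, Λ8 (P x) = P (Λ8 x)) (T : N →ₗ[ℝ] M) (φk : M) (ψ : N) :
    scalarForms a Λ8 Δ Q (φk + T ψ) ψ = quadPhi a Λ8 Δ P φk + crossTerms a Λ8 Δ Q T φk ψ + quadPsi a Λ8 Δ Q T ψ := by
  rw [expand_transl a hΔ Q T φk ψ, eq582 a Δ hP hΛsym hΛΛ hΛP φk]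

/-- *"This is because (5.8.1) would eliminate entirely the linear term were it not for the localizations"* (p. 295): given an
adjoint `Q*` of `Q`, the cross terms are `⟨φ^{(k)}, Wψ⟩` with `W = Λ₈ΔΛ₈T − aQ*(1 − QT)` — they vanish for all `φ^{(k)}` exactly when
`aQ*(1 − QT) = Λ₈ΔΛ₈T` (the unlocalized B1 translation); with the localizations the residual kernel is the paper's `w₆` (plus `𝒬₅`),
whose smallness is not claimed. [cite: BalabanImbrieJaffe1988, (5.8.2) p.295] -/
theorem crossTerms_eq_inner (a : ℝ) {Λ8 Δ : M →ₗ[ℝ] M} {Q : M →ₗ[ℝ] N} {Qst : N →ₗ[ℝ] M}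
    (hΛsym : ∀ x y : M, ⟪Λ8 x, y⟫ = ⟪x, Λ8 y⟫) (hQst : ∀ (x : M) (y : N), ⟪Q x, y⟫ = ⟪x, Qst y⟫)
    (T : N →ₗ[ℝ] M) (φk : M) (ψ : N) :
    crossTerms a Λ8 Δ Q T φk ψ = ⟪φk, Λ8 (Δ (Λ8 (T ψ))) - a • Qst (ψ - Q (T ψ))⟫ := by
  rw [crossTerms]
  conv_rhs => rw [inner_sub_right, real_inner_smul_right, ← hΛsym, ← hQst]

end Literature.MathematicalPhysics.QuantumFieldTheory.BalabanImbrieJaffe1984to88.BIJ88ScalarTransl582
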